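import Mathlib
import HarnessLib
import Summits.HubbardSuperconductivity.HubbardSuperconductivity.Theorems.KLProgrammeKLRegimeEnginePairTransferGridRunningGram
import Literature.MathematicalPhysics.QuantumLattice.GrassmannEffectiveActionBoundDB

/-!
# Route `KLProgramme` — ENGINE child gen 8 (stmt-HubbardSuperconductivity-20437 `KLRegimeEngineV17F2`), skeleton v2 class #5 rev 3: the STEP's `N_g(Λ(t))` ONE PARTIAL GRID STEP from the grid-scale
# export — `klmg_gridPartitionFn_eq`, **`klmg_gridAction_running_eq_partialStep`**, **`klmg_isGramBoundedR_gridSub_partialSlice`**, **`klmg_gridNorms_running_of_partialStep`**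
# (cell gate-hubbard-kl, seat hubbard-kl-k3c1-p1 g14, technique «composed-map remainder propagation»; pen (R192) word (a): class #1 exports label-blind GRID pinned norms of `Gg(Λₙ)` —
# «(N_g)-GRID-EXPORT» — and «the continuum-slice `N_g(Λ(t))` is one partial grid step away»: this file is that step, parametric in the step data)

WHY.  Row 54b (`exists_isTransferPkg7_of_analytic_closed`, the (X).3 order of record) reads, per scale and `t ∈ [0,1]`, the pinned GRID kernel norms `N_g` of the grid action at the RUNNING cutoff
`Gg(Λ(t)) = effAction (SᵀC^K_{>Λ(t)}S)(V_N + 𝒩_{K,N})`, `Λ(t) = Λₙ + t(Λₙ₊₁ − Λₙ)`, while the class-#1 export of record (R192) is the same object AT THE GRID SCALES `Λₙ`.  By the semigroup of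
the Wilsonian effective action (`effAction_add`, intermediate `Z ≠ 0`) and `C^K_{>Λ(t)} = (C^K_{>Λ(t)} − C^K_{>Λₙ}) + C^K_{>Λₙ}`:
* `klmg_gridPartitionFn_eq` — `effPartitionFn (SᵀC^K_{>Λ}S) Ṽ = Z^K_Λ` (`effPartitionFn_map`, `map_hubbardGridSub_gridInteractionCT`): the grid step's unit condition IS the slice's `Z ≠ 0` row;
* **`klmg_gridAction_running_eq_partialStep`** — `Z^K_{Λₙ} ≠ 0 ⇒ Gg(Λ(t)) = effAction (Sᵀ(C^K_{>Λ(t)} − C^K_{>Λₙ})S) (Gg(Λₙ))` — ONE Gaussian step with the PARTIAL-slice covariance;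
* **`klmg_isGramBoundedR_gridSub_partialSlice`** — its Gram constant DISCHARGED: `C^K_{>Λ(t)} − C^K_{>Λₙ} = softCovOf K (w^K_{Λ(t)} − w^K_{Λₙ})` (`klmf_carrierCov_eq` at `ψ = 0`), a soft symbol in
  `[0, 1 − w^K_{Λₙ}]`, so `IsGramBoundedR (Sᵀ(C^K_{>Λ(t)} − C^K_{>Λₙ})S) √6047` for every admissible frame, `klBetaMin ≤ β ≤ L`, `t ∈ [0,1]`, every grid (row 45's mass lemma +
  `infraredGram_frame_le` at `max(Λₙ, π/β) ≤ e₀`);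
* **`klmg_gridNorms_running_of_partialStep`** — the door: from the pinned grid norms `Nₙ` of `Gg(Λₙ)` [class #1, grid scale], the Gram constant `κ` and the decay `α` (row/column sums) of the
  partial-slice pullback, a field weight `ρ > 0` and the step smallness `e·α·normV(κ,ρ,Nₙ)/κ² < 1` (Literature `sum_norm_kernel_gaussConv…`/`sum_norm_kernel_effAction_le_of_gramBounded`,
  BGM06 (2.77)–(2.80)): every pinned grid norm of `Gg(Λ(t))` in degree `m > 0` is `≤ ρ⁻ᵐ·e·normV/(1 − θ)` — i.e. row 54b's `N_g(m′) := ρ^{−2m′}·e·normV/(1−θ)`, uniformly in `t`.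
So 54b's kernel input reduces to: class #1's GRID norms at GRID scales + the partial slice's decay constant `α` (the one remaining analytic number; the Gram constant is √6047 here) + smallness.
Composition over landed Literature; nothing about the model's sizes beyond the Gram mass is asserted; nothing asserts (X).3, (c), K3 or superconductivity.  0 kit · 0 lit.
-/

noncomputable section

namespace Summit.HubbardSuperconductivity.HubbardSuperconductivity.Theorems.KLRegimeSplit

set_option linter.dupNamespace false -- summit = problem name (single-conjunct summit), D-0017

open Finset Matrix Set Literature.MathematicalPhysics.QuantumLattice Literature.Probability.LatticeModels GrassmannAlgebra
open Summit.HubbardSuperconductivity.HubbardSuperconductivity.Theorems.KLProgrammeLegKernels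
open Summit.HubbardSuperconductivity.HubbardSuperconductivity.Theorems.DispersionFlow
open Summit.HubbardSuperconductivity.HubbardSuperconductivity.Theorems.KLRegimeWick
open Summit.HubbardSuperconductivity.HubbardSuperconductivity.Theorems.EngineV8

variable (L M : ℕ) [NeZero L] [NeZero M] (β U μ : ℝ) (K : TrigPolyC4v)

/-! ## §1 The grid step's partition function and the partial-step identity -/

/-- **The grid step's partition function is the slice's `Z`**: `effPartitionFn (SᵀC^K_{>Λ}S)(V_N + 𝒩_{K,N}) = Z^K_Λ` (`β ≠ 0`, grid `N = 4M`). -/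
theorem klmg_gridPartitionFn_eq (hβ : β ≠ 0) (Λ : ℝ) :
    effPartitionFn ℂ ((hubbardGridSub L M β (2 * (2 * M))).transpose * hubbardCovAboveCT L M β μ 0 K Λ * hubbardGridSub L M β (2 * (2 * M)))
        (hubbardGridInteraction L (2 * (2 * M)) β U + hubbardGridCounterQuadratic L (2 * (2 * M)) β K) =
      hubbardEffPartitionFnCT L M β U μ 0 K Λ := by
  haveI : NeZero (2 * (2 * M)) := ⟨by have := NeZero.ne M; omega⟩
  have h := effPartitionFn_map ℂ (Matrix.toLin' (hubbardGridSub L M β (2 * (2 * M)))) (hubbardCovAboveCT L M β μ 0 K Λ)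
    (hubbardGridInteraction L (2 * (2 * M)) β U + hubbardGridCounterQuadratic L (2 * (2 * M)) β K)
  rw [LinearMap.toMatrix'_toLin', map_hubbardGridSub_gridInteractionCT (L := L) (M := M) (N := 2 * (2 * M)) hβ U K (by omega) (by omega)] at h
  rw [← h]
  rfl

/-- **`klmg_gridAction_running_eq_partialStep`** — `Z^K_{Λₙ} ≠ 0 ⇒ Gg(Λ(t)) = effAction (Sᵀ(C^K_{>Λ(t)} − C^K_{>Λₙ})S) (Gg(Λₙ))` (semigroup `effAction_add`). -/
theorem klmg_gridAction_running_eq_partialStep (hβ : β ≠ 0) (n : ℕ) (t : ℝ)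
    (hZ : hubbardEffPartitionFnCT L M β U μ 0 K (klScale klE0 n) ≠ 0) :
    effAction ℂ ((hubbardGridSub L M β (2 * (2 * M))).transpose * hubbardCovAboveCT L M β μ 0 K (klScale klE0 n + t * (klScale klE0 (n + 1) - klScale klE0 n)) *
        hubbardGridSub L M β (2 * (2 * M))) (hubbardGridInteraction L (2 * (2 * M)) β U + hubbardGridCounterQuadratic L (2 * (2 * M)) β K) =
      effAction ℂ ((hubbardGridSub L M β (2 * (2 * M))).transpose *
          (hubbardCovAboveCT L M β μ 0 K (klScale klE0 n + t * (klScale klE0 (n + 1) - klScale klE0 n)) - hubbardCovAboveCT L M β μ 0 K (klScale klE0 n)) *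
            hubbardGridSub L M β (2 * (2 * M)))
        (effAction ℂ ((hubbardGridSub L M β (2 * (2 * M))).transpose * hubbardCovAboveCT L M β μ 0 K (klScale klE0 n) * hubbardGridSub L M β (2 * (2 * M)))
          (hubbardGridInteraction L (2 * (2 * M)) β U + hubbardGridCounterQuadratic L (2 * (2 * M)) β K)) := by
  have hunit : IsUnit (effPartitionFn ℂ ((hubbardGridSub L M β (2 * (2 * M))).transpose * hubbardCovAboveCT L M β μ 0 K (klScale klE0 n) *
      hubbardGridSub L M β (2 * (2 * M))) (hubbardGridInteraction L (2 * (2 * M)) β U + hubbardGridCounterQuadratic L (2 * (2 * M)) β K)) := by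
    rw [klmg_gridPartitionFn_eq L M β U μ K hβ]
    exact isUnit_iff_ne_zero.2 hZ
  have hsplit : (hubbardGridSub L M β (2 * (2 * M))).transpose * hubbardCovAboveCT L M β μ 0 K (klScale klE0 n + t * (klScale klE0 (n + 1) - klScale klE0 n)) *
        hubbardGridSub L M β (2 * (2 * M)) =
      (hubbardGridSub L M β (2 * (2 * M))).transpose *
          (hubbardCovAboveCT L M β μ 0 K (klScale klE0 n + t * (klScale klE0 (n + 1) - klScale klE0 n)) - hubbardCovAboveCT L M β μ 0 K (klScale klE0 n)) *
            hubbardGridSub L M β (2 * (2 * M)) +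
        (hubbardGridSub L M β (2 * (2 * M))).transpose * hubbardCovAboveCT L M β μ 0 K (klScale klE0 n) * hubbardGridSub L M β (2 * (2 * M)) := by
    rw [← Matrix.add_mul, ← Matrix.mul_add, sub_add_cancel]
  rw [hsplit, effAction_add ℂ _ _ _ hunit]

/-! ## §2 The partial slice's Gram constant (a mass) -/

omit [NeZero M] in
/-- The partial-slice covariance is the soft covariance of the symbol `w^K_{Λ(t)} − w^K_{Λₙ}`. -/
theorem klmg_partialSlice_eq_softCovOf (n : ℕ) (t : ℝ) :
    hubbardCovAboveCT L M β μ 0 K (klScale klE0 n + t * (klScale klE0 (n + 1) - klScale klE0 n)) - hubbardCovAboveCT L M β μ 0 K (klScale klE0 n) =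
      softCovOf L M β μ K (fun k => hubbardCutoffWeightCT L M β μ K (klScale klE0 n + t * (klScale klE0 (n + 1) - klScale klE0 n)) k -
        hubbardCutoffWeightCT L M β μ K (klScale klE0 n) k) := by
  have h := klmf_carrierCov_eq L M β μ K (fun _ => (0 : ℝ)) (klScale klE0 n + t * (klScale klE0 (n + 1) - klScale klE0 n)) (klScale klE0 n)
  rw [softCovOf_zero, zero_add] at h
  rw [h]
  congr 1
  funext k
  ring

omit [NeZero M] in
/-- **`klmg_isGramBoundedR_gridSub_partialSlice`** — the partial slice's grid Gram constant DISCHARGED: for an admissible frame (`FrameOK R U N μ K`), `klBetaMin ≤ β ≤ L`, `t ∈ [0,1]`,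
every grid `Ng`: `IsGramBoundedR (Sᵀ·(C^K_{>Λ(t)} − C^K_{>Λₙ})·S) √6047`. -/
theorem klmg_isGramBoundedR_gridSub_partialSlice {R : RenConsts} {U' : ℝ} {Nsc : ℕ} (hK : FrameOK R U' Nsc μ K)
    (hβ : klBetaMin ≤ β) (hβL : β ≤ L) (n : ℕ) {t : ℝ} (ht : t ∈ Icc (0 : ℝ) 1) (Ng : ℕ) :
    IsGramBoundedR ((hubbardGridSub L M β Ng).transpose *
        (hubbardCovAboveCT L M β μ 0 K (klScale klE0 n + t * (klScale klE0 (n + 1) - klScale klE0 n)) - hubbardCovAboveCT L M β μ 0 K (klScale klE0 n)) *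
          hubbardGridSub L M β Ng) (Real.sqrt 6047) := by
  have hβ0 : 0 < β := pos_of_klBetaMin_le hβ
  have hL : (0 : ℝ) < L := by exact_mod_cast Nat.pos_of_ne_zero (NeZero.ne L)
  have hβL2 : 0 < β * (L : ℝ) ^ 2 := by positivity
  set Λt : ℝ := klScale klE0 n + t * (klScale klE0 (n + 1) - klScale klE0 n) with hΛt
  set Λs : ℝ := max (klScale klE0 n) (Real.pi / β) with hΛs
  obtain ⟨hlo, hhi⟩ := scaleAt_mem n ht
  have hΛt0 : 0 < Λt := lt_of_lt_of_le (klth_klScale_pos (n + 1)) hlo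
  have hΛn : 0 < klScale klE0 n := klth_klScale_pos n
  have he₀' : klE0 ≤ 3 / 80 := by norm_num [klE0]
  have hn0 : klScale klE0 n ≤ klE0 := by
    unfold klScale
    have hE0 : (0 : ℝ) ≤ klE0 := by norm_num [klE0]
    have h4 : (1 : ℝ) ≤ (4 : ℝ) ^ n := one_le_pow₀ (by norm_num)
    calc klE0 * ((4 : ℝ) ^ n)⁻¹ ≤ klE0 * 1 := mul_le_mul_of_nonneg_left (inv_le_one_of_one_le₀ h4) hE0
      _ = klE0 := mul_one _
  have hπβ : Real.pi / β ≤ klE0 := by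
    rw [div_le_iff₀ hβ0, klE0]
    have h128 : (128 : ℝ) ≤ β := by simpa [klBetaMin] using hβ
    nlinarith [Real.pi_lt_four]
  have hΛs_le : Λs ≤ klE0 := max_le hn0 hπβ
  have hΛs_pos : 0 < Λs := lt_of_lt_of_le hΛn (le_max_left _ _)
  have hsum := infraredGram_frame_le (L := L) (M := M) hK hβ0 hΛs_pos (le_max_right _ _) (hΛs_le.trans he₀') hβL
  rw [klmg_partialSlice_eq_softCovOf L M β μ K n t]
  refine klmg_isGramBoundedR_gridSub_softCovOf_of_mass_le L M hβ0 μ K Ng _ (Real.sqrt_nonneg _) ?_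
  rw [Real.sq_sqrt (by norm_num)]
  -- termwise `0 ≤ w_{Λ(t)} − w_{Λₙ} ≤ 1 − w_{Λₙ} ≤ 1 − w_{Λ*}`
  have hterm : ∀ k : FreqMomentum L M,
      |hubbardCutoffWeightCT L M β μ K Λt k - hubbardCutoffWeightCT L M β μ K (klScale klE0 n) k| /
          Real.sqrt (matsubaraFreq β M k.1 ^ 2 + nambuXiCT L μ K k.2 ^ 2) ≤
        (1 - hubbardCutoffWeightCT L M β μ K Λs k) / Real.sqrt (matsubaraFreq β M k.1 ^ 2 + nambuXiCT L μ K k.2 ^ 2) := by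
    intro k
    refine div_le_div_of_nonneg_right ?_ (Real.sqrt_nonneg _)
    have h1 : hubbardCutoffWeightCT L M β μ K (klScale klE0 n) k ≤ hubbardCutoffWeightCT L M β μ K Λt k :=
      klmg_hubbardCutoffWeightCT_anti L M β μ K hΛt0 hhi k
    have h2 : hubbardCutoffWeightCT L M β μ K Λt k ≤ 1 := (salmhoferCutoff_mem_Icc _).2
    have h3 : hubbardCutoffWeightCT L M β μ K Λs k ≤ hubbardCutoffWeightCT L M β μ K (klScale klE0 n) k :=
      klmg_hubbardCutoffWeightCT_anti L M β μ K hΛn (le_max_left _ _) k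
    rw [abs_of_nonneg (by linarith)]
    linarith
  calc 1 / (β * (L : ℝ) ^ 2) * ∑ k : FreqMomentum L M, |hubbardCutoffWeightCT L M β μ K Λt k - hubbardCutoffWeightCT L M β μ K (klScale klE0 n) k| /
          Real.sqrt (matsubaraFreq β M k.1 ^ 2 + nambuXiCT L μ K k.2 ^ 2)
      ≤ 1 / (β * (L : ℝ) ^ 2) * ∑ k : FreqMomentum L M, (1 - hubbardCutoffWeightCT L M β μ K Λs k) / Real.sqrt (matsubaraFreq β M k.1 ^ 2 + nambuXiCT L μ K k.2 ^ 2) :=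
        mul_le_mul_of_nonneg_left (sum_le_sum fun k _ => hterm k) (by positivity)
    _ ≤ 1 / (β * (L : ℝ) ^ 2) * ((7 * 1793 * Λs + (Λs + 8) * 704) * β * (L : ℝ) ^ 2) := mul_le_mul_of_nonneg_left hsum (by positivity)
    _ = 7 * 1793 * Λs + (Λs + 8) * 704 := by field_simp
    _ ≤ 6047 := by rw [klE0] at hΛs_le; nlinarith

/-! ## §3 The door: `N_g(Λ(t))` from the grid-scale export and the partial step's data -/

/-- **`klmg_gridNorms_running_of_partialStep`** — the STEP's pinned GRID kernel norms at the running cutoff from ONE partial determinant-bounded step: `Z^K_{Λₙ} ≠ 0`, pinned grid norms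
`Nₙ` of `Gg(Λₙ)` [class #1, grid scale], `IsGramBoundedR (Sᵀ(C^K_{>Λ(t)} − C^K_{>Λₙ})S) κ` (e.g. `κ = √6047`, `klmg_isGramBoundedR_gridSub_partialSlice`), row/column sums of that pullback
`≤ α` (the partial slice's decay constant), a weight `ρ > 0`, and `θ = e·α·normV(κ,ρ,Nₙ)/κ² < 1` ⟹ for every `m > 0`, pin `i`, grid leg `w`:
`Σ_{Y : Y i = w}‖kernel_m(Gg(Λ(t)))(Y)‖ ≤ ρ⁻ᵐ·(e·normV(κ,ρ,Nₙ))/(1 − θ)` — row 54b's `N_g(m′) := ρ^{−2m′}·e·normV/(1−θ)`. -/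
theorem klmg_gridNorms_running_of_partialStep (hβ : β ≠ 0) (n : ℕ) (t : ℝ)
    (hZ : hubbardEffPartitionFnCT L M β U μ 0 K (klScale klE0 n) ≠ 0)
    {κ : ℝ} (hκ : 0 < κ)
    (hGB : IsGramBoundedR ((hubbardGridSub L M β (2 * (2 * M))).transpose *
        (hubbardCovAboveCT L M β μ 0 K (klScale klE0 n + t * (klScale klE0 (n + 1) - klScale klE0 n)) - hubbardCovAboveCT L M β μ 0 K (klScale klE0 n)) *
          hubbardGridSub L M β (2 * (2 * M))) κ)
    (Nn : ℕ → ℝ) (hN0 : ∀ m', 0 ≤ Nn m')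
    (hN : ∀ m' (j : Fin (2 * m')) (w : GridLeg (GridPoint L (2 * (2 * M)))),
      ∑ Y ∈ univ.filter (fun Y : Fin (2 * m') → GridLeg (GridPoint L (2 * (2 * M))) => Y j = w),
        ‖kernel ℂ (effAction ℂ ((hubbardGridSub L M β (2 * (2 * M))).transpose * hubbardCovAboveCT L M β μ 0 K (klScale klE0 n) * hubbardGridSub L M β (2 * (2 * M)))
          (hubbardGridInteraction L (2 * (2 * M)) β U + hubbardGridCounterQuadratic L (2 * (2 * M)) β K)) (2 * m') Y‖ ≤ Nn m')
    {α : ℝ} (hα : 0 < α)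
    (hrow : ∀ X, ∑ Y, ‖((hubbardGridSub L M β (2 * (2 * M))).transpose *
        (hubbardCovAboveCT L M β μ 0 K (klScale klE0 n + t * (klScale klE0 (n + 1) - klScale klE0 n)) - hubbardCovAboveCT L M β μ 0 K (klScale klE0 n)) *
          hubbardGridSub L M β (2 * (2 * M))) X Y‖ ≤ α)
    (hcol : ∀ Y, ∑ X, ‖((hubbardGridSub L M β (2 * (2 * M))).transpose *
        (hubbardCovAboveCT L M β μ 0 K (klScale klE0 n + t * (klScale klE0 (n + 1) - klScale klE0 n)) - hubbardCovAboveCT L M β μ 0 K (klScale klE0 n)) *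
          hubbardGridSub L M β (2 * (2 * M))) X Y‖ ≤ α)
    {ρ : ℝ} (hρ : 0 < ρ)
    (hθ : Real.exp 1 * α * normV (GridLeg (GridPoint L (2 * (2 * M)))) κ ρ Nn / κ ^ 2 < 1)
    {m : ℕ} (hm : 0 < m) (i : Fin m) (w : GridLeg (GridPoint L (2 * (2 * M)))) :
    ∑ Y ∈ univ.filter (fun Y : Fin m → GridLeg (GridPoint L (2 * (2 * M))) => Y i = w),
        ‖kernel ℂ (effAction ℂ ((hubbardGridSub L M β (2 * (2 * M))).transpose *
            hubbardCovAboveCT L M β μ 0 K (klScale klE0 n + t * (klScale klE0 (n + 1) - klScale klE0 n)) * hubbardGridSub L M β (2 * (2 * M)))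
          (hubbardGridInteraction L (2 * (2 * M)) β U + hubbardGridCounterQuadratic L (2 * (2 * M)) β K)) m Y‖ ≤
      ρ⁻¹ ^ m * (Real.exp 1 * normV (GridLeg (GridPoint L (2 * (2 * M)))) κ ρ Nn) /
        (1 - Real.exp 1 * α * normV (GridLeg (GridPoint L (2 * (2 * M)))) κ ρ Nn / κ ^ 2) := by
  have hunit : IsUnit (effPartitionFn ℂ ((hubbardGridSub L M β (2 * (2 * M))).transpose * hubbardCovAboveCT L M β μ 0 K (klScale klE0 n) *
      hubbardGridSub L M β (2 * (2 * M))) (hubbardGridInteraction L (2 * (2 * M)) β U + hubbardGridCounterQuadratic L (2 * (2 * M)) β K)) := by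
    rw [klmg_gridPartitionFn_eq L M β U μ K hβ]
    exact isUnit_iff_ne_zero.2 hZ
  rw [klmg_gridAction_running_eq_partialStep L M β U μ K hβ n t hZ]
  exact (sum_norm_kernel_effAction_le_of_gramBounded _ hκ hGB _ (klmg_gridAction_mem_evenPart L β U K _) (constPart_effAction ℂ _ _ hunit) Nn hN0 hN
    hα hrow hcol hρ hθ).2 hm i w

end Summit.HubbardSuperconductivity.HubbardSuperconductivity.Theorems.KLRegimeSplit

end
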